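import Mathlib

/-!
# Crux `PercNearOneGluing.NoHeavyLowerTail` (stmt-CriticalPhenomena-4575), line
`bhk-superadditivity-thinning` — stub `starPatternReduce` (star pattern ↦ relay set)

Helper file for the crux skeleton (lead prover-line-stmt-CriticalPhenomena-4575-c3-0): proves
exactly the registered stub signature `starPatternReduce`; lands with
`--supports stmt-CriticalPhenomena-4575`.

## Content

Weighted complete graph on `Fin n` (weights `w : Sym2 (Fin n) → [0,1]`), a hub `o`, a set `A ∌ o`
of relay points.  Write `F_o = {e | o ∈ e}` for the pairs at `o` (including the loop `s(o,o)`),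
`Pw ξ = (∏_{e ∈ ξ} w e) (∏_{e ∈ F_o \ ξ} (1 - w e))` for the Bernoulli weight of a star pattern
`ξ ⊆ F_o`, and `PA S = (∏_{a ∈ S} w s(o,a)) (∏_{a ∈ A \ S} (1 - w s(o,a)))` for the weight of a
relay set `S ⊆ A`.  If every pair `s(o,v)` with `v ∉ A`, `v ≠ o` has weight `0` and `g` does not
see the loop (`g (insert s(o,o) ξ) = g ξ`), then

`∑_{ξ ⊆ F_o} Pw ξ · g ξ = ∑_{S ⊆ A} PA S · g (s(o, ·) '' S)`:

the law of the star pattern of `o` collapses to the law of the set of relay points opened from `o`.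

## Proof

* `starPR_sum_powerset_insert` — conditioning a Bernoulli subset sum on one coordinate `e ∉ K`:
  `∑_{ξ ⊆ insert e K} Pw ξ g ξ = ∑_{ξ ⊆ K} Pw ξ (w e · g (insert e ξ) + (1 - w e) · g ξ)`
  (`Finset.sum_powerset_insert`).
* `starPR_sum_powerset_union_irrel` — hence every coordinate `e` with
  `w e · g (insert e ξ) + (1 - w e) · g ξ = g ξ` (weight `0`, or invisible to `g`) drops out;
  induction over a finite set `R` of such coordinates.
* `starPR_sum_powerset_image` — pushing a Bernoulli subset sum along an injection
  (`Finset.powerset_image`, `Finset.sum_image`, `Finset.prod_image`, `Finset.image_sdiff`).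
* `starPatternReduce` — split `F_o = (F_o \ F_A) ∪ F_A` with `F_A = s(o, ·) '' A ⊆ F_o`; a pair of
  `F_o \ F_A` is `s(o,v)` (`Sym2.mem_iff_exists`) with either `v = o` (the loop, invisible to `g`)
  or `v ∉ A`, `v ≠ o` (weight `0`), so `F_o \ F_A` drops out, and the remaining sum over
  `ξ ⊆ F_A` is reindexed by `S ⊆ A` along the injection `a ↦ s(o,a)` (`Sym2.congr_right`).

The two conditioning lemmas are adapted from
`Literature/Probability/Percolation/DiagonalStripTransferRecursion.lean`
(`sum_powerset_insert_bernoulli`, `sum_powerset_image_bernoulli`).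
-/

open scoped Classical

namespace Summit.CriticalPhenomena.PercolationContinuityZ3.Theorems

section StarPatternReduceAux

variable {α β : Type*} [DecidableEq α] [DecidableEq β]

/-- **Conditioning a Bernoulli subset sum on one coordinate.**  For `e ∉ K`, splitting the sum of
`(∏_{ξ} u) (∏_{(insert e K) \ ξ} (1 - u)) F ξ` over `ξ ⊆ insert e K` according to whether `e ∈ ξ`
gives the sum over `ξ ⊆ K` of the `K`-weights times `u e · F (insert e ξ) + (1 - u e) · F ξ`.
A polynomial identity (`Finset.sum_powerset_insert`). [folklore] -/
theorem starPR_sum_powerset_insert {e : α} {K : Finset α} (he : e ∉ K) (u : α → ℝ)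
    (F : Finset α → ℝ) :
    ∑ ξ ∈ (insert e K).powerset, ((∏ p ∈ ξ, u p) * ∏ p ∈ insert e K \ ξ, (1 - u p)) * F ξ =
      ∑ ξ ∈ K.powerset, ((∏ p ∈ ξ, u p) * ∏ p ∈ K \ ξ, (1 - u p)) *
        (u e * F (insert e ξ) + (1 - u e) * F ξ) := by
  -- adapted from Literature/Probability/Percolation/DiagonalStripTransferRecursion.lean
  -- (`sum_powerset_insert_bernoulli`)
  rw [Finset.sum_powerset_insert he]
  have h1 : ∀ ξ ∈ K.powerset, ((∏ p ∈ ξ, u p) * ∏ p ∈ insert e K \ ξ, (1 - u p)) * F ξ =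
      ((∏ p ∈ ξ, u p) * ∏ p ∈ K \ ξ, (1 - u p)) * ((1 - u e) * F ξ) := by
    intro ξ hξ
    have hξK : ξ ⊆ K := Finset.mem_powerset.1 hξ
    have heξ : e ∉ ξ := fun h => he (hξK h)
    rw [Finset.insert_sdiff_of_notMem K heξ,
      Finset.prod_insert (fun h => he (Finset.mem_sdiff.1 h).1)]
    ring
  have h2 : ∀ ξ ∈ K.powerset,
      ((∏ p ∈ insert e ξ, u p) * ∏ p ∈ insert e K \ insert e ξ, (1 - u p)) * F (insert e ξ) =
        ((∏ p ∈ ξ, u p) * ∏ p ∈ K \ ξ, (1 - u p)) * (u e * F (insert e ξ)) := by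
    intro ξ hξ
    have hξK : ξ ⊆ K := Finset.mem_powerset.1 hξ
    have heξ : e ∉ ξ := fun h => he (hξK h)
    rw [Finset.prod_insert heξ, Finset.insert_sdiff_insert, Finset.sdiff_insert_of_notMem he]
    ring
  rw [Finset.sum_congr rfl h1, Finset.sum_congr rfl h2, ← Finset.sum_add_distrib]
  refine Finset.sum_congr rfl fun ξ _ => ?_
  ring

/-- **Irrelevant coordinates drop out of a Bernoulli subset sum.**  If `R` is disjoint from `K`
and every coordinate `e ∈ R` satisfies `u e · F (insert e ξ) + (1 - u e) · F ξ = F ξ` for all `ξ`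
(e.g. `u e = 0`, or `F` does not see `e`), then the Bernoulli sum of `F` over `ξ ⊆ R ∪ K` equals
the Bernoulli sum over `ξ ⊆ K`.  Induction on `R` using `starPR_sum_powerset_insert`.
[folklore] -/
theorem starPR_sum_powerset_union_irrel (u : α → ℝ) (F : Finset α → ℝ) (R K : Finset α)
    (hRK : Disjoint R K)
    (hR : ∀ e ∈ R, ∀ ξ : Finset α, u e * F (insert e ξ) + (1 - u e) * F ξ = F ξ) :
    ∑ ξ ∈ (R ∪ K).powerset, ((∏ p ∈ ξ, u p) * ∏ p ∈ (R ∪ K) \ ξ, (1 - u p)) * F ξ =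
      ∑ ξ ∈ K.powerset, ((∏ p ∈ ξ, u p) * ∏ p ∈ K \ ξ, (1 - u p)) * F ξ := by
  induction R using Finset.induction_on with
  | empty => rw [Finset.empty_union]
  | insert e R heR ih =>
    have heK : e ∉ K := Finset.disjoint_left.1 hRK (Finset.mem_insert_self e R)
    have hRK' : Disjoint R K := Finset.disjoint_of_subset_left (Finset.subset_insert e R) hRK
    have heRK : e ∉ R ∪ K := by
      rw [Finset.mem_union, not_or]
      exact ⟨heR, heK⟩
    rw [Finset.insert_union, starPR_sum_powerset_insert heRK,
      Finset.sum_congr rfl (fun ξ _ => by rw [hR e (Finset.mem_insert_self e R) ξ])]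
    exact ih hRK' (fun e' he' => hR e' (Finset.mem_insert_of_mem he'))

/-- **Pushing a Bernoulli subset sum along an injection.**  For `ι` injective, the Bernoulli sum
of `G` over `ξ ⊆ ι '' L` with weights `u` is the Bernoulli sum over `S ⊆ L` with weights `u ∘ ι`
of `G (ι '' S)` (`Finset.powerset_image`, `Finset.sum_image`, `Finset.prod_image`,
`Finset.image_sdiff`). [folklore] -/
theorem starPR_sum_powerset_image (L : Finset β) {ι : β → α} (hι : Function.Injective ι)
    (u : α → ℝ) (G : Finset α → ℝ) :
    ∑ ξ ∈ (L.image ι).powerset, ((∏ p ∈ ξ, u p) * ∏ p ∈ L.image ι \ ξ, (1 - u p)) * G ξ =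
      ∑ S ∈ L.powerset, ((∏ a ∈ S, u (ι a)) * ∏ a ∈ L \ S, (1 - u (ι a))) * G (S.image ι) := by
  -- adapted from Literature/Probability/Percolation/DiagonalStripTransferRecursion.lean
  -- (`sum_powerset_image_bernoulli`)
  rw [Finset.powerset_image, Finset.sum_image fun I _ J _ h => Finset.image_injective hι h]
  refine Finset.sum_congr rfl fun S _ => ?_
  rw [Finset.prod_image fun a _ b _ h => hι h, ← Finset.image_sdiff _ _ hι,
    Finset.prod_image fun a _ b _ h => hι h]

end StarPatternReduceAux

/-- **Star pattern ↦ relay set** (stub `starPatternReduce` of stmt-CriticalPhenomena-4575).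
With `F_o = {e | o ∈ e}` the pairs at the hub `o` (loop included), `A ∌ o` the relay points, if
every pair `s(o,v)` with `v ∉ A`, `v ≠ o` has weight `0` and `g (insert s(o,o) ξ) = g ξ`, then
`∑_{ξ ⊆ F_o} (∏_{ξ} w) (∏_{F_o \ ξ} (1 - w)) g ξ
   = ∑_{S ⊆ A} (∏_{a ∈ S} w s(o,a)) (∏_{a ∈ A \ S} (1 - w s(o,a))) g (s(o,·) '' S)`:
the law of the star pattern of `o` is the law of the set of relay points opened from `o`.
Proof: the coordinates of `F_o \ s(o,·) '' A` are the loop (invisible to `g`) and weight-`0`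
pairs, so they drop out (`starPR_sum_powerset_union_irrel`); the rest is reindexed along the
injection `a ↦ s(o,a)` (`starPR_sum_powerset_image`, `Sym2.congr_right`). -/
theorem starPatternReduce : ∀ (n : ℕ) (w : Sym2 (Fin n) → unitInterval) (A : Finset (Fin n)) (o : Fin n) (g : Finset (Sym2 (Fin n)) → ℝ), o ∉ A → (∀ v : Fin n, v ∉ A → v ≠ o → w s(o, v) = 0) → (∀ ξ : Finset (Sym2 (Fin n)), g (insert s(o, o) ξ) = g ξ) → ∑ ξ ∈ ((Finset.univ : Finset (Sym2 (Fin n))).filter (fun e => o ∈ e)).powerset, ((∏ e ∈ ξ, ((w e : unitInterval) : ℝ)) * ∏ e ∈ ((Finset.univ : Finset (Sym2 (Fin n))).filter (fun e => o ∈ e)) \ ξ, (1 - ((w e : unitInterval) : ℝ))) * g ξ = ∑ S ∈ A.powerset, ((∏ a ∈ S, ((w s(o, a) : unitInterval) : ℝ)) * ∏ a ∈ A \ S, (1 - ((w s(o, a) : unitInterval) : ℝ))) * g (S.image (fun a => s(o, a))) := by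
  intro n w A o g hoA hw0 hg
  set Fo : Finset (Sym2 (Fin n)) := (Finset.univ : Finset (Sym2 (Fin n))).filter (fun e => o ∈ e)
    with hFo
  have hιinj : Function.Injective (fun a : Fin n => s(o, a)) := fun a b h => Sym2.congr_right.1 h
  set FA : Finset (Sym2 (Fin n)) := A.image (fun a : Fin n => s(o, a)) with hFA
  have hFAFo : FA ⊆ Fo := by
    intro e he
    obtain ⟨a, -, rfl⟩ := Finset.mem_image.1 he
    exact Finset.mem_filter.2 ⟨Finset.mem_univ _, Sym2.mem_mk_left o a⟩
  have hsplit : Fo = (Fo \ FA) ∪ FA := (Finset.sdiff_union_of_subset hFAFo).symm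
  have hdisj : Disjoint (Fo \ FA) FA := Finset.sdiff_disjoint
  have hirrel : ∀ e ∈ Fo \ FA, ∀ ξ : Finset (Sym2 (Fin n)),
      (fun e : Sym2 (Fin n) => ((w e : unitInterval) : ℝ)) e * g (insert e ξ) +
        (1 - (fun e : Sym2 (Fin n) => ((w e : unitInterval) : ℝ)) e) * g ξ = g ξ := by
    intro e he ξ
    obtain ⟨heFo, heFA⟩ := Finset.mem_sdiff.1 he
    have hoe : o ∈ e := (Finset.mem_filter.1 heFo).2
    obtain ⟨v, rfl⟩ := Sym2.mem_iff_exists.1 hoe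
    by_cases hvo : v = o
    · rw [hvo, hg ξ]
      ring
    · have hvA : v ∉ A := fun hvA => heFA (Finset.mem_image.2 ⟨v, hvA, rfl⟩)
      simp only [hw0 v hvA hvo, Set.Icc.coe_zero, zero_mul, sub_zero, one_mul, zero_add]
  have h1 := starPR_sum_powerset_union_irrel (fun e : Sym2 (Fin n) => ((w e : unitInterval) : ℝ))
    g (Fo \ FA) FA hdisj hirrel
  have h2 := starPR_sum_powerset_image A hιinj (fun e : Sym2 (Fin n) => ((w e : unitInterval) : ℝ)) g
  rw [hsplit]
  exact h1.trans h2

end Summit.CriticalPhenomena.PercolationContinuityZ3.Theorems
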